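import Literature.MathematicalPhysics.QuantumFieldTheory.Balaban1983to89.B9Thm34SectBFinal

/-!
# `Balaban1983to89.B9Thm34SectBUniformR1` — [Balaban1985BackgroundPropagators] THEOREM 3.4 p. 400, the `G′(U′U)`- and
# `(Q′G′²Q′*)⁻¹(U′U)`-clauses with the constants chosen before the lattice (r06 FILE 45 `B9Thm34SectBUniform`), RESTATED WITH THE
# [4] LEMMA 2.1 INPUTS ASKED ONLY FOR THE EXPONENTS THE PROOF USES: `9/5000 ≤ α` instead of `0 < α` in the two Lemma-2.1 binders
# («R1» of the pub-ymgap N06 row-13 lineage, seat dag-n06-c gen 3/4; statement-only change, proofs verbatim)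

statement-level skeleton of published theorems with citation tags; proofs where landed; nothing here is a claim about the Yang–Mills mass gap

CITATION HEADER (lean-in-tree rule).  B9 = T. Bałaban, *Propagators for lattice gauge theories in a background field*, Commun. Math. Phys.
**99** (1985) 389–434 [Balaban1985BackgroundPropagators] (held `paper:balaban1985-cmp99-background-propagators`; journal page = PDF page + 388):
Theorem 3.4 p. 400 [PDF 12] L7–10 «There exists a positive constant a₁ such that the operators G′(U), (Q′(U)G′²(U)Q′*(U))⁻¹, R(U), G(U) extend
to configurations U′U for α₁ ≦ a₁ as analytic functions of A. The extended operators satisfy all the inequalities of Theorems 3.1–3.3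
correspondingly»; Theorem 3.1 p. 397 [PDF 9] «There exist positive constants M₁, δ₀, a₀, B₀ dependent on d and L only»; p. 399 [PDF 11]
L1–3 «Let us stress that the constants in the formulations of both theorems do not depend on the sequence {Ω_j}, j = 0, 1, …, k, if the
conditions (2.1), (2.2) are satisfied»; p. 402 [PDF 14] L23 «We assume that Theorem 3.1 is valid for the operator G′(U)», (3.60)–(3.65); p. 403 [PDF 15]
L5–7 «of course with different constants, although changes are small», (3.65)–(3.67) «The inverse satisfies Theorem 3.2»; Thm 3.1 (3.42) p. 397; Thm 3.2 (3.48)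
p. 398 [PDF 10]; p. 398 remark after (3.47) «Using Lemma 2.1 in [4] we may replace the factor (Lʲη)^α by (Lʲη)^β(L^{j′}η)^γ with β + γ = α»;
(3.19)/(3.21)/(3.24) pp. 393–394; (3.57)/(3.59) pp. 401–402; (3.35)/(3.37) p. 396.  [4] = [Balaban1984PropagatorsII] Lemma 2.1 p. 234
[PDF 12]: «For the numbers α, 0 < α < 1, c₁(α) = 12c₀(½α), and RM satisfying (2.59) … (2.60) … (2.61)»; (2.59) p. 233 [PDF 11]: «Now we require
that RM is sufficiently large, i.e. we assume ¼αδ₀RM > 2d log c₀(½α) + 1. (2.59)».  Rows B9.Thm3.4 × B9.Thm3.1 × B9.Thm3.2 × B6.Lemma2.1 (cells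
only; no row head changes).

WHY THIS FILE (pub-ymgap N06 row 13, dag-n06-c LOCATED-4, pub-ymgap INBOX 2026-08-27 ≈01:47Z/02:01Z).  r06's uniform Sect.-B theorems (FILE 45
`B9Thm34SectBUniform` and its 16 siblings) hypothesise [4] Lemma 2.1 in the shape «for EVERY 0 < α < 1»: `∀ α, 0 < α → α < 1 → Ineq261 d 𝔅 δ₀ α`
and `∀ α, 0 < α → ScaleTransfer 𝔅 δ₀ α (Λ α) …` — with NO trace of the printed size condition (2.59), whose M-threshold grows without bound as
α → 0.  Over a family of multiscale geometries with unboundedly many scales at a fixed M (the geometry of every UV-limit record), that hypothesis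
is therefore FALSE at every member with enough scales (the (2.61) row sum at rate αδ₀ below the (2.59) threshold grows like (L^d e^{−αδ₀RM})^k),
although each theorem USES it at finitely many literal exponents only — the union over the 17 files is {9/5000, 33/10000, 49/5000, 1/100, 1/25,
1/20, 1/10, 3/5} (FILE 45: 1/100 and 49/5000).  THIS FILE is FILE 45 with the two binder texts `0 < α → α < 1 → Ineq261 …` ⟶
`9 / 5000 ≤ α → α < 1 → Ineq261 …` and `0 < α → ScaleTransfer …` ⟶ `9 / 5000 ≤ α → ScaleTransfer …` (the smallest exponent any file of the
chain uses, so that callers pass the binders through unchanged) and NOTHING ELSE changed: the proofs are r06's, byte for byte (the side goals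
`0 < 1/100` become `9/5000 ≤ 1/100`, closed by the same `norm_num`).  The restated hypothesis is the one a multiscale family CAN supply: (2.59) is
monotone in α, so one M-threshold serves every α ∈ [9/5000, 1) at a given rate.  An in-place edit of FILE 45 would break its seven importers'
pass-through sites until they are edited in the same pass; this sibling module is the count-neutral, supersedable form of that edit
(if the r06 chain is ever restated in place, this file becomes redundant and may be retired).  Siblings of the same pass: `…B9Thm34GUniformR1`
(FILE 47), `…B9Thm34HolderGpUniformR1` (the `G′`-parts of FILES 51/53).

WHAT IS PROVED (0 `def`, 0 sorry, 0 new named facts; standard axioms) — FILE 45's three theorems under the same short names in the namespace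
`…B9Thm34SectBUniformR1`:
* §1 **`thm34_Gp_uniform`** — the `G′(U′U)`-clause: `∃ a₁ > 0 ∃ B ≧ 0 ∀ S T U g blk kQ sQ cfun w (axioms, [4] Lemma 2.1 FOR 9/5000 ≦ α < 1, scale
  transfer FOR 9/5000 ≦ α with the given Λ(·), (3.19)/(3.24)/(3.60) data, Theorem 3.1 for G′(U)) ∀ α₁ ≦ a₁ ∀ A kF sF …`: `G′(U′U) := gPrimeExtEnd
  G′(U) (V′(A)G′(U))` is the two-sided inverse of `Δ′_a(U) − V′(A)` and every left entry `X·G′(U) ≺ B_G P e^{−δ₀d}` / right entry `G′(U)·Y ≺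
  B_G Lʲη e^{−δ₀d}` transfers to `G′(U′U)` at `(B, 9δ₀/10)`.
* §2 **`thm34_Cinv_uniform`** — the `(Q′G′²Q′*)⁻¹(U′U)`-clause in the printed kernel form (3.48) at the rate `9δ₀/25`.
* §3 **`thm34_GpCinv_uniform`** — §1 and §2 under ONE `a₁` and ONE `B`.

PROOF.  r06's FILE 45 proofs verbatim (gen 9's `B9Ineq363Vprime.thm34_Gp_entries13_vPrime` / `gpExt_leftEntry_vPrime` / `gpExt_rightEntry_vPrime`,
`B9Ineq366Vprime.inverse_satisfies_thm32_vPrime` at the cascade `(δ₀, 1/100)`, `(49δ₀/50, 1/100)`, `(δ₀, 3/5)`, `(2δ₀/5, 1/10)`; `ineq261_rescale`,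
`scaleTransfer_rescale`, `exists_threshold_of_continuousAt`, `neumann_le_two` of `B9Thm34GFinal`).

HONEST SCOPE / NOT CLAIMED.  As FILE 45 (Theorems 3.1/3.2 FOR `U` are inputs; (3.37) read blockwise; letters as block-majorant hypotheses of the
printed shape; rates `9δ₀/10`, `9δ₀/25` one admissible choice).  The ONLY difference to FILE 45 is the weaker Lemma-2.1 hypothesis; the number
9/5000 is a proof constant of the r06 chain, not a printed one (print: «0 < α < 1» together with (2.59)).  Nothing of [B9] is asserted; no row head
changes; NOT a node discharge; nothing continuum / OS / mass-gap / Clay.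

RELATED IN THE TREE, NOT DUPLICATED: FILE 45 `B9Thm34SectBUniform` (the «∀ 0 < α < 1» statements; kept — it has seven importers), FILE 26
`B9Thm34SectBFinal` (per-lattice quantifiers) and everything it uses BY NAME; no existing module modified.
-/

noncomputable section

namespace Literature.MathematicalPhysics.QuantumFieldTheory.Balaban1983to89.B9Thm34SectBUniformR1

open NormedSpace Complex
open Literature.MathematicalPhysics.QuantumFieldTheory.Balaban1983to89
open Literature.MathematicalPhysics.QuantumFieldTheory.Balaban1983to89.B6RandomWalk (HasMajorant hasMajorant_mono Triangle254 Ineq261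
  c1_nonneg)
open Literature.MathematicalPhysics.QuantumFieldTheory.Balaban1983to89.B6RandomWalkHom (HasMajorantHom hasMajorantHom_mono hasMajorantHom_iff
  hasMajorantHom_zero)
open Literature.MathematicalPhysics.QuantumFieldTheory.Balaban1983to89.B9Thm34Ext (toB6)
open Literature.MathematicalPhysics.QuantumFieldTheory.Balaban1983to89.B9Ineq347 (ScaleTransfer)
open Literature.MathematicalPhysics.QuantumFieldTheory.Balaban1983to89.B9Ineq366CPrime (hasMajorant_rate_mono kappa366 kappa366_nonneg
  kappa366_pos)
open Literature.MathematicalPhysics.QuantumFieldTheory.Balaban1983to89.B9Ineq385VG (kappa385 kappa385_nonneg)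
open Literature.MathematicalPhysics.QuantumFieldTheory.Balaban1983to89.B9Eq39Adjoint
open Literature.MathematicalPhysics.QuantumFieldTheory.Balaban1983to89.B9Eq352DivForm (tauF tauB)
open Literature.MathematicalPhysics.QuantumFieldTheory.Balaban1983to89.B9Eq352DivFormLetters
open Literature.MathematicalPhysics.QuantumFieldTheory.Balaban1983to89.B9Eq352GradLetters (diffLetter)
open Literature.MathematicalPhysics.QuantumFieldTheory.Balaban1983to89.B9Eq360Vprime (gPrimeExtEnd)
open Literature.MathematicalPhysics.QuantumFieldTheory.Balaban1983to89.B9Eq360VprimeLetters (vPrimeConc cBConc cCConc)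
open Literature.MathematicalPhysics.QuantumFieldTheory.Balaban1983to89.B9Ineq363Vprime (cVConc cVConc_nonneg theta363 thetaL363
  theta363_nonneg thetaL363_nonneg thm34_Gp_entries13_vPrime gpExt_leftEntry_vPrime gpExt_rightEntry_vPrime)
open Literature.MathematicalPhysics.QuantumFieldTheory.Balaban1983to89.B9Ineq366Vprime (inverse_satisfies_thm32_vPrime)
open Literature.MathematicalPhysics.QuantumFieldTheory.Balaban1983to89.B9Thm34GFinal (ineq261_rescale scaleTransfer_rescale
  c1_pos_of_ineq261 exists_threshold_of_continuousAt neumann_le_two)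

/-! ## §1  Theorem 3.4, the `G′(U′U)`-clause with `a₁`, `B` chosen before the lattice -/

section Gp

variable {𝔸 : Type*} [NormedRing 𝔸] [NormedAlgebra ℂ 𝔸] [CompleteSpace 𝔸] {ι : Type} [Fintype ι]
variable (b : Module.Basis ι ℝ 𝔸) (κ : Type) [Fintype κ]

set_option maxHeartbeats 800000 in
/-- **THEOREM 3.4, `G′(U′U)`-CLAUSE, CONSTANTS BEFORE THE LATTICE** («There exists a positive constant a₁ …», p. 400; «the constants … do
not depend on the sequence {Ω_j}», p. 399; «We define new constants in such a way that the statements of Theorem 3.1 hold for extended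
operators», p. 403): for fixed `d`, direction type `κ`, algebra `(𝔸, b)` with real-coordinate constant `M₂`, input constants `δ₀, B_G, C_q,
a₀, d₀` and ONE scale-transfer function `Λ(·) ≧ 1` (p. 398 / [4] Lemma 2.1), THERE EXIST `a₁ > 0` and `B ≧ 0` such that FOR EVERY lattice
`(S, T)`, multiscale geometry `𝔅 = g` with block map `blk` (axioms, [4] (2.61) at `δ₀` and the scale transfer with `Λ(α)` for
every exponent `9/5000 ≦ α (< 1)` — R1), background `U` (unitary type, stencil range `d₀`), (3.19)/(3.24)/(3.60) data, and `G′(U) = (Δ′_a(U))⁻¹` obeying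
Theorem 3.1 (3.42)₁₋₃ at `(B_G, δ₀)`: for all `0 ≦ α₁ ≦ a₁`, all `A` in (3.37) (blockwise) and (3.59) kernels, `G′(U′U) = gPrimeExtEnd G′(U)
(V′(A)G′(U))` is the two-sided inverse of `Δ′_a(U) − V′(A)` and every left entry `X·G′(U) ≺ B_G P e^{−δ₀d}` / right entry
`G′(U)·Y ≺ B_G Lʲη e^{−δ₀d}` transfers to `G′(U′U)` at `(B, 9δ₀/10)`.  (`a₁`, `B` = FILE 26's values read at `Λ(1/100)`, `Λ(49/5000)`.) (R1: [4] Lemma 2.1 (2.61) and the p. 398 scale transfer are hypothesised for the exponents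
`9/5000 ≦ α` only — the ones the proof uses — instead of r06's «every 0 < α < 1»; nothing else differs from FILE 45.)
[cite: Balaban1985BackgroundPropagators, Thm 3.4 p.400 + p.399 + (3.60)–(3.65) p.402 + p.403 + Thm 3.1 (3.42) p.397 + p.398 remark + (3.24) p.394 + (3.19) p.393 + (3.59) p.402 + (3.37) p.396; Balaban1984PropagatorsII, Lemma 2.1 p.234 + (2.66) p.234] -/
theorem thm34_Gp_uniform [DecidableEq ι] (d : ℕ) (δ₀ BG Cq a₀ d₀ M₂ : ℝ) (Λf : ℝ → ℝ)
    (hBG : 0 < BG) (hCq : 0 ≤ Cq) (ha₀ : 0 ≤ a₀) (hM₂ : 0 ≤ M₂) (hδ₀ : 0 < δ₀) (hΛf : ∀ α : ℝ, 0 < α → 1 ≤ Λf α)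
    (hrepr : ∀ (v : 𝔸) (i : ι), |b.repr v i| ≤ M₂ * ‖v‖) :
    ∃ a₁ : ℝ, 0 < a₁ ∧ ∃ B : ℝ, 0 ≤ B ∧
    ∀ {S : Type} [Fintype S] [DecidableEq S] (T : κ → Equiv.Perm S) (U : κ → S → 𝔸ˣ)
      {g : B9.Geometry} [Fintype g.Site] [DecidableEq g.Site] [Nonempty g.Site] {Rr : ℝ} {H : Prop} (blk : S → g.Site)
      (kQ : g.Site → S → 𝔸 →L[ℝ] 𝔸) (sQ : S → 𝔸 →L[ℝ] 𝔸) (cfun w : g.Site → ℝ),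
    -- the multiscale geometry 𝔅 (p. 393, [4] (2.1)–(2.4)) and its axioms
      (∀ a a' : g.Site, 0 ≤ g.dist a a') → Triangle254 (toB6 g Rr H) → (∀ y : g.Site, g.dist y y = 0) →
      (∀ y y' : g.Site, g.dist y y' = g.dist y' y) → (∀ y : g.Site, 0 < g.len y) → (∀ y : g.Site, g.eta ≤ g.len y) → 0 < g.eta →
    -- [4] Lemma 2.1 (2.61) at the rate `δ₀` and the p. 398 scale transfer with the constant `Λ(α)`, for every exponent `9/5000 ≤ α (< 1)` (R1: the exponents the proof uses)
      (∀ α : ℝ, 9 / 5000 ≤ α → α < 1 → Ineq261 d (toB6 g Rr H) δ₀ α) →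
      (∀ α : ℝ, 9 / 5000 ≤ α → ScaleTransfer g δ₀ α (Λf α) (fun a => g.len a) ∧ ScaleTransfer g δ₀ α (Λf α) (fun a => g.len a ^ 2) ∧
        ScaleTransfer g δ₀ α (Λf α) (fun a => (g.len a)⁻¹) ∧ ScaleTransfer g δ₀ α (Λf α) (fun a => (g.len a ^ 2)⁻¹) ∧
        ScaleTransfer g δ₀ α (Λf α) (fun a => (g.len a ^ 4)⁻¹) ∧ ScaleTransfer g δ₀ α (Λf α) (fun y => g.len y ^ (-(4 : ℝ)))) →
    -- unitary-type background, stencil geometry at range `d₀`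
      (∀ m z, ‖((U m z : 𝔸ˣ) : 𝔸)‖ ≤ 1 ∧ ‖(((U m z)⁻¹ : 𝔸ˣ) : 𝔸)‖ ≤ 1) →
      (∀ μ x, g.dist (blk x) (blk ((T μ).symm x)) ≤ d₀) → (∀ μ x, g.dist (blk x) (blk (T μ x)) ≤ d₀) →
      (∀ y : g.Site, g.dist y y ≤ d₀) →
    -- the `A`-independent data of the concrete `V′(A)` of (3.60)
      (∀ y, 0 ≤ w y) → (∀ y, ((B9Eq360Vprime.block blk y).card : ℝ) * w y ≤ 1) →
      (∀ y x, blk x = y → ‖kQ y x‖ ≤ w y) → (∀ x, ‖sQ x‖ ≤ 1) → (∀ y, |cfun y| ≤ a₀ * (g.len y ^ 2)⁻¹) →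
    -- THEOREM 3.1 for `G′(U)`: (3.24) `G′(U) = (Δ′_a(U))⁻¹` for the letter `Δ′_a(U)`, and (3.42)₁,₂,₃ at the rate `δ₀`
    ∀ {Δp Gp : Module.End ℝ (S × ι → ℝ)}, Δp * Gp = 1 → Gp * Δp = 1 →
      HasMajorant (g := toB6 g Rr H) (fun p : S × ι => blk p.1) Gp (fun a a' => BG * g.len a ^ 2 * Real.exp (-(δ₀ * g.dist a a'))) →
      (∀ k : κ ⊕ κ, HasMajorant (g := toB6 g Rr H) (fun p : S × ι => blk p.1)
        (conj b (diffLetter T U ((g.eta : ℂ)⁻¹) k) * Gp) (fun a a' => BG * g.len a * Real.exp (-(δ₀ * g.dist a a')))) →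
      (∀ k : κ ⊕ κ, HasMajorant (g := toB6 g Rr H) (fun p : S × ι => blk p.1)
        (Gp * conj b (diffLetter T U ((g.eta : ℂ)⁻¹) k)) (fun a a' => BG * g.len a * Real.exp (-(δ₀ * g.dist a a')))) →
    ∀ (α₁ : ℝ), 0 ≤ α₁ → α₁ ≤ a₁ →
    -- the exponent field `A` in the domain (3.37), read blockwise, and the `A`-dependent (3.59) data `kF`, `sF`
    ∀ (A : κ → S → 𝔸) (kF : g.Site → S → 𝔸 →L[ℝ] 𝔸) (sF : S → 𝔸 →L[ℝ] 𝔸),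
      (∀ y x, blk x = y → ‖kF y x‖ ≤ Cq * α₁ * w y) → (∀ x, ‖sF x‖ ≤ Cq * α₁) →
      (∀ ν k x, ‖((g.eta : ℂ)⁻¹) • covDstar T U ν (A k) x‖ ≤ α₁ * (g.len (blk x) ^ 2)⁻¹) →
      (∀ μ ν x, ‖((g.eta : ℂ)⁻¹) • covD T U μ (A ν) x‖ ≤ α₁ * (g.len (blk x) ^ 2)⁻¹) →
      (∀ μ x, ‖((g.eta : ℂ)⁻¹) • covDstar T U μ (tauB T U μ (A μ)) x‖ ≤ α₁ * (g.len (blk x) ^ 2)⁻¹) →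
      (∀ k x, ‖A k x‖ ≤ α₁ * (g.len (blk x))⁻¹) → (∀ ν k x, ‖tauB T U ν (A k) x‖ ≤ α₁ * (g.len (blk x))⁻¹) →
      (Δp - conj b (vPrimeConc T U g.eta A blk kQ kF sQ sF cfun)) * (gPrimeExtEnd Gp (conj b (vPrimeConc T U g.eta A blk kQ kF sQ sF cfun) * Gp)) = 1 ∧
      (gPrimeExtEnd Gp (conj b (vPrimeConc T U g.eta A blk kQ kF sQ sF cfun) * Gp)) * (Δp - conj b (vPrimeConc T U g.eta A blk kQ kF sQ sF cfun)) = 1 ∧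
      (∀ (X : Module.End ℝ (S × ι → ℝ)) (P : g.Site → ℝ), (∀ y, 0 ≤ P y) →
        HasMajorant (g := toB6 g Rr H) (fun p : S × ι => blk p.1) (X * Gp) (fun a a' => BG * P a * Real.exp (-(δ₀ * g.dist a a'))) →
        HasMajorant (g := toB6 g Rr H) (fun p : S × ι => blk p.1) (X * (gPrimeExtEnd Gp (conj b (vPrimeConc T U g.eta A blk kQ kF sQ sF cfun) * Gp)))
          (fun a a' => B * P a * Real.exp (-(9 / 10 * δ₀ * g.dist a a')))) ∧
      (∀ Y : Module.End ℝ (S × ι → ℝ),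
        HasMajorant (g := toB6 g Rr H) (fun p : S × ι => blk p.1) (Gp * Y) (fun a a' => BG * g.len a * Real.exp (-(δ₀ * g.dist a a'))) →
        HasMajorant (g := toB6 g Rr H) (fun p : S × ι => blk p.1) ((gPrimeExtEnd Gp (conj b (vPrimeConc T U g.eta A blk kQ kF sQ sF cfun) * Gp)) * Y)
          (fun a a' => B * g.len a * Real.exp (-(9 / 10 * δ₀ * g.dist a a')))) := by
  classical
  have hSb : 0 ≤ ∑ i, ‖b i‖ := Finset.sum_nonneg fun i _ => norm_nonneg _
  -- the two scale-transfer constants of the chain, READ FROM THE GIVEN FUNCTION `Λ(·)` (lattice-free)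
  have hΛ : 1 ≤ Λf (1 / 100) := hΛf _ (by norm_num)
  have hΛρ1 : 1 ≤ Λf (1 / 100 * (49 / 50)) := hΛf _ (by norm_num)
  have hΛ0 : 0 < Λf (1 / 100) := zero_lt_one.trans_le hΛ
  have hΛρ : 0 ≤ Λf (1 / 100 * (49 / 50)) := zero_le_one.trans hΛρ1
  have hc0' : 0 ≤ B6.c1 d (49 / 50 * δ₀) (1 / 100) := c1_nonneg _ _ _
  -- «for α₁ sufficiently small» (p. 402): `θ₃₆₃c₁`, `θ_Lc₁` are continuous at `α₁ = 0` and vanish there — NO lattice datum enters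
  obtain ⟨ε₁, hε₁, hF1⟩ := exists_threshold_of_continuousAt
    (f := fun α₁ : ℝ => theta363 (Fintype.card κ) 1 α₁ a₀ Cq M₂ (∑ i, ‖b i‖) (Real.exp (δ₀ * d₀)) BG (Λf (1 / 100)) (B6.c1 d δ₀ (1 / 100)) *
      B6.c1 d (49 / 50 * δ₀) (1 / 100))
    (by unfold theta363 kappa385 cVConc cBConc; fun_prop) (by simp [theta363])
  obtain ⟨ε₂, hε₂, hF2⟩ := exists_threshold_of_continuousAt
    (f := fun α₁ : ℝ => thetaL363 (Fintype.card κ) 1 α₁ a₀ Cq M₂ (∑ i, ‖b i‖) (Real.exp (δ₀ * d₀)) BG (Λf (1 / 100)) (B6.c1 d δ₀ (1 / 100)) *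
      B6.c1 d (49 / 50 * δ₀) (1 / 100))
    (by unfold thetaL363 kappa385 cVConc cBConc; fun_prop) (by simp [thetaL363])
  have hBnn : 0 ≤ 2 * BG * Λf (1 / 100 * (49 / 50)) ^ 2 * B6.c1 d (49 / 50 * δ₀) (1 / 100) :=
    mul_nonneg (mul_nonneg (mul_nonneg zero_le_two hBG.le) (sq_nonneg _)) hc0'
  refine ⟨min (min ε₁ ε₂) (1 / 2) / 2, half_pos (lt_min (lt_min hε₁ hε₂) one_half_pos),
    2 * BG * Λf (1 / 100 * (49 / 50)) ^ 2 * B6.c1 d (49 / 50 * δ₀) (1 / 100), hBnn, ?_⟩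
  -- NOW the lattice, the background, the data and Theorem 3.1 for `U`
  intro S _ _ T U g _ _ _ Rr H blk kQ sQ cfun w hdnn htri hrefl hsym hlen hlenη hη h261 hST hU1 hd₀B hd₀F hd₀0 hw hcard hkQ hsQ hcfun Δp Gp
    hΔpGp hGpΔp h342_1 h342_2 h342_3 α₁ hα₁0 hα₁1 A kF sF hkF hsF h337B h337F h337Bτ hA hAτB
  obtain ⟨y₀⟩ := ‹Nonempty g.Site›
  -- the p. 398 scale transfers and [4] Lemma 2.1 at the pairs `(δ₀, 1/100)`, `(49δ₀/50, 1/100)`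
  obtain ⟨hT1, hT2, hT1i, hT2i, -, -⟩ := hST (1 / 100) (by norm_num)
  obtain ⟨hTρ0, -, -, -, -, -⟩ := hST (1 / 100 * (49 / 50)) (by norm_num)
  have hTρ : ScaleTransfer g (49 / 50 * δ₀) (1 / 100) (Λf (1 / 100 * (49 / 50))) (fun a => g.len a) := scaleTransfer_rescale hTρ0
  have h261β : Ineq261 d (toB6 g Rr H) δ₀ (1 / 100) := h261 _ (by norm_num) (by norm_num)
  have h261c : Ineq261 d (toB6 g Rr H) (49 / 50 * δ₀) (1 / 100) :=
    ineq261_rescale (h261 (1 / 100 * (49 / 50)) (by norm_num) (by norm_num))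
  have hcc' : 0 < B6.c1 d (49 / 50 * δ₀) (1 / 100) := c1_pos_of_ineq261 h261c y₀ (hrefl y₀)
  have hrc1 : 49 / 50 * δ₀ + (1 / 100 + 1 / 100) * δ₀ ≤ δ₀ := by linarith only [hδ₀]
  have hρc0 : 0 ≤ 49 / 50 * δ₀ := by linarith only [hδ₀]
  have hα'ρ : 0 ≤ (1 - 1 / 100) * (49 / 50 * δ₀) := by linarith only [hδ₀]
  have hα'ρ0 : 0 ≤ 1 / 100 * (49 / 50 * δ₀) := by linarith only [hδ₀]
  have hα'ρ2 : 0 ≤ (1 - 2 * (1 / 100)) * (49 / 50 * δ₀) := by linarith only [hδ₀]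
  have hmε₁ : min (min ε₁ ε₂) (1 / 2) ≤ ε₁ := (min_le_left _ _).trans (min_le_left _ _)
  have hmε₂ : min (min ε₁ ε₂) (1 / 2) ≤ ε₂ := (min_le_left _ _).trans (min_le_right _ _)
  have hmh : min (min ε₁ ε₂) (1 / 2) ≤ 1 / 2 := min_le_right _ _
  have habs : |α₁| = α₁ := abs_of_nonneg hα₁0
  have h1 : theta363 (Fintype.card κ) 1 α₁ a₀ Cq M₂ (∑ i, ‖b i‖) (Real.exp (δ₀ * d₀)) BG (Λf (1 / 100)) (B6.c1 d δ₀ (1 / 100)) *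
      B6.c1 d (49 / 50 * δ₀) (1 / 100) < 1 / 2 :=
    hF1 α₁ (by rw [habs]; linarith only [hα₁1, hmε₁, hε₁])
  have h2 : thetaL363 (Fintype.card κ) 1 α₁ a₀ Cq M₂ (∑ i, ‖b i‖) (Real.exp (δ₀ * d₀)) BG (Λf (1 / 100)) (B6.c1 d δ₀ (1 / 100)) *
      B6.c1 d (49 / 50 * δ₀) (1 / 100) < 1 / 2 :=
    hF2 α₁ (by rw [habs]; linarith only [hα₁1, hmε₂, hε₂])
  have hhalf : (1 / 2 : ℝ) < 1 := by norm_num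
  -- `η·α₁(Lʲη)⁻¹ ≦ 1/4` from `α₁ ≦ 1/4` and `η ≦ Lʲη`
  have hsmall : ∀ y : g.Site, g.eta * (α₁ * (g.len y)⁻¹) ≤ 1 / 4 := fun y => by
    have hq : g.eta * (g.len y)⁻¹ ≤ 1 := by
      rw [← div_eq_mul_inv]; exact (div_le_one (hlen y)).mpr (hlenη y)
    calc g.eta * (α₁ * (g.len y)⁻¹) = α₁ * (g.eta * (g.len y)⁻¹) := by ring
      _ ≤ α₁ * 1 := mul_le_mul_of_nonneg_left hq hα₁0
      _ ≤ 1 / 4 := by linarith only [hα₁1, hmh]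
  -- the shapes gen 9's `B9Ineq363Vprime` reads (3.37) / the stencil geometry in
  have hA' : ∀ μ x, ‖A μ x‖ ≤ α₁ * (g.len (blk x))⁻¹ ∧ ‖tauB T U μ (A μ) x‖ ≤ α₁ * (g.len (blk x))⁻¹ :=
    fun μ x => ⟨hA μ x, hAτB μ μ x⟩
  have h337s' : ∀ μ x, ‖((g.eta : ℂ)⁻¹) • covDstar T U μ (A μ) x‖ ≤ α₁ * (g.len (blk x) ^ 2)⁻¹ := fun μ x => h337B μ μ x
  have h337F' : ∀ μ x, ‖((g.eta : ℂ)⁻¹) • covD T U μ (A μ) x‖ ≤ α₁ * (g.len (blk x) ^ 2)⁻¹ := fun μ x => h337F μ μ x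
  have hd₀' : ∀ μ x, g.dist (blk x) (blk (T μ x)) ≤ d₀ ∧ g.dist (blk x) (blk ((T μ).symm x)) ≤ d₀ :=
    fun μ x => ⟨hd₀F μ x, hd₀B μ x⟩
  -- a dummy right letter for gen 9's fourth conjunct (discarded)
  have hGDs0 : HasMajorant (g := toB6 g Rr H) (fun p : S × ι => blk p.1) (Gp * 0)
      (fun a a' => BG * g.len a * Real.exp (-(δ₀ * g.dist a a'))) := by
    rw [mul_zero]
    exact hasMajorant_mono (g := toB6 g Rr H) _
      ((hasMajorantHom_iff (g := toB6 g Rr H) _ _ _).mp (hasMajorantHom_zero (g := toB6 g Rr H) _ _))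
      fun a a' => mul_nonneg (mul_nonneg hBG.le (hlen a).le) (Real.exp_nonneg _)
  -- existence: `G′(U′U)` is the two-sided inverse of `Δ′_a(U) − V′(A)` (gen 9)
  obtain ⟨i1, i2, -, -⟩ := thm34_Gp_entries13_vPrime (Rr := Rr) (H := H) b T U blk d hη A kQ kF sQ sF cfun w 1 d₀ M₂ Cq a₀ δ₀ δ₀
    (1 / 100) (1 / 100) (49 / 50 * δ₀) (Λf (1 / 100)) (Λf (1 / 100 * (49 / 50))) BG α₁ (1 / 100) hBG.le hα₁0 hΛ0.le hΛρ hρc0 (by norm_num)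
    (by norm_num) hδ₀.le hδ₀.le hrc1 (by norm_num) hα'ρ hα'ρ0 hα'ρ2 hdnn hrefl hsym htri hlen h261β h261c hT1 hT2 hT1i hT2i hTρ hM₂ hrepr
    hsmall hA' h337s' h337F' h337Bτ hU1 hd₀' hd₀0 hw hcard hCq ha₀ hkQ hkF hsQ hsF hcfun (h1.trans hhalf) (h2.trans hhalf) Δp Gp hΔpGp
    hGpΔp (Ds := 0) h342_1 h342_2 h342_3 hGDs0
  -- the rate and constant weakenings
  have hexpρ : ∀ a a' : g.Site, Real.exp (-(δ₀ * g.dist a a')) ≤ Real.exp (-(49 / 50 * δ₀ * g.dist a a')) := fun a a' => by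
    have h0 : 0 ≤ δ₀ * g.dist a a' := mul_nonneg hδ₀.le (hdnn a a')
    exact Real.exp_le_exp.mpr (by linarith only [h0])
  have hc0 : 0 ≤ BG * B6.c1 d (49 / 50 * δ₀) (1 / 100) := mul_nonneg hBG.le hcc'.le
  have hBle1 : BG * B6.c1 d (49 / 50 * δ₀) (1 / 100) * 2 ≤ 2 * BG * Λf (1 / 100 * (49 / 50)) ^ 2 * B6.c1 d (49 / 50 * δ₀) (1 / 100) :=
    calc BG * B6.c1 d (49 / 50 * δ₀) (1 / 100) * 2 = 2 * (BG * B6.c1 d (49 / 50 * δ₀) (1 / 100)) * 1 := by ring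
      _ ≤ 2 * (BG * B6.c1 d (49 / 50 * δ₀) (1 / 100)) * Λf (1 / 100 * (49 / 50)) ^ 2 :=
          mul_le_mul_of_nonneg_left (one_le_pow₀ hΛρ1) (mul_nonneg zero_le_two hc0)
      _ = 2 * BG * Λf (1 / 100 * (49 / 50)) ^ 2 * B6.c1 d (49 / 50 * δ₀) (1 / 100) := by ring
  have hBle3 : BG * Λf (1 / 100 * (49 / 50)) ^ 2 * B6.c1 d (49 / 50 * δ₀) (1 / 100) * 2 ≤
      2 * BG * Λf (1 / 100 * (49 / 50)) ^ 2 * B6.c1 d (49 / 50 * δ₀) (1 / 100) :=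
    le_of_eq (by ring)
  refine ⟨i1, i2, fun X P hP0 hX => ?_, fun Y hY => ?_⟩
  · -- every left entry, by gen 9's `gpExt_leftEntry_vPrime` (second form of (3.65))
    have hXρ : HasMajorantHom (g := toB6 g Rr H) (fun p : S × ι => blk p.1) (fun p : S × ι => blk p.1) (X ∘ₗ Gp)
        (fun a a' => BG * P a * Real.exp (-(49 / 50 * δ₀ * g.dist a a'))) :=
      hasMajorantHom_mono (g := toB6 g Rr H) _ _ ((hasMajorantHom_iff (g := toB6 g Rr H) _ _ _).mpr hX) fun a a' =>
        mul_le_mul_of_nonneg_left (hexpρ a a') (mul_nonneg hBG.le (hP0 a))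
    have h := gpExt_leftEntry_vPrime (Rr := Rr) (H := H) b T U blk (fun p : S × ι => blk p.1) d hη A kQ kF sQ sF cfun w 1 d₀ M₂ Cq a₀
      δ₀ δ₀ (1 / 100) (1 / 100) (49 / 50 * δ₀) (Λf (1 / 100)) BG α₁ (1 / 100) P hBG.le hP0 hα₁0 hΛ0.le hρc0 (by norm_num) (by norm_num)
      hδ₀.le hδ₀.le hrc1 hα'ρ (by norm_num) hdnn hrefl htri hlen h261β h261c hT1 hT2 hM₂ hrepr hsmall hA' h337s' hU1 hd₀' hd₀0 hw hcard
      hCq ha₀ hkQ hkF hsQ hsF hcfun (h1.trans hhalf) (E := X) h342_1 h342_2 hXρ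
    refine hasMajorant_mono (g := toB6 g Rr H) _ ((hasMajorantHom_iff (g := toB6 g Rr H) _ _ _).mp h) fun a a' => ?_
    have h0 : 0 ≤ δ₀ * g.dist a a' := mul_nonneg hδ₀.le (hdnn a a')
    have hexp9 : Real.exp (-((1 - 1 / 100) * (49 / 50 * δ₀) * g.dist a a')) ≤ Real.exp (-(9 / 10 * δ₀ * g.dist a a')) :=
      Real.exp_le_exp.mpr (by linarith only [h0])
    exact mul_le_mul (mul_le_mul_of_nonneg_right ((mul_le_mul_of_nonneg_left (neumann_le_two h1) hc0).trans hBle1) (hP0 a))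
      hexp9 (Real.exp_pos _).le (mul_nonneg hBnn (hP0 a))
  · -- every right entry, by gen 9's `gpExt_rightEntry_vPrime` (first form of (3.65))
    have h := gpExt_rightEntry_vPrime (Rr := Rr) (H := H) b T U blk d hη A kQ kF sQ sF cfun w 1 d₀ M₂ Cq a₀ δ₀ δ₀ (1 / 100) (1 / 100)
      (49 / 50 * δ₀) (Λf (1 / 100)) (Λf (1 / 100 * (49 / 50))) BG α₁ (1 / 100) hBG.le hα₁0 hΛ0.le hΛρ hρc0 (by norm_num) (by norm_num)
      hδ₀.le hδ₀.le hrc1 (by norm_num) hα'ρ hα'ρ0 hα'ρ2 hdnn hrefl hsym htri hlen h261β h261c hT1 hT2 hT1i hT2i hTρ hM₂ hrepr hsmall hA'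
      h337s' h337F' h337Bτ hU1 hd₀' hd₀0 hw hcard hCq ha₀ hkQ hkF hsQ hsF hcfun (h1.trans hhalf) (h2.trans hhalf) (Ds := Y) h342_1 h342_2
      h342_3 hY
    refine hasMajorant_mono (g := toB6 g Rr H) _ h fun a a' => ?_
    have h0 : 0 ≤ δ₀ * g.dist a a' := mul_nonneg hδ₀.le (hdnn a a')
    have hexp9 : Real.exp (-((1 - 3 * (1 / 100)) * (49 / 50 * δ₀) * g.dist a a')) ≤ Real.exp (-(9 / 10 * δ₀ * g.dist a a')) :=
      Real.exp_le_exp.mpr (by linarith only [h0])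
    exact mul_le_mul (mul_le_mul_of_nonneg_right
      ((mul_le_mul_of_nonneg_left (neumann_le_two h2) (mul_nonneg (mul_nonneg hBG.le (sq_nonneg _)) hcc'.le)).trans hBle3) (hlen a).le)
      hexp9 (Real.exp_pos _).le (mul_nonneg hBnn (hlen a).le)

end Gp

/-! ## §2  Theorem 3.4, the `(Q′G′²Q′*)⁻¹(U′U)`-clause in the printed kernel form (3.48) with `a₁` chosen before the lattice -/

section CInv

variable {𝔸 : Type*} [NormedRing 𝔸] [NormedAlgebra ℂ 𝔸] [CompleteSpace 𝔸] {ι : Type} [Fintype ι]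
variable (b : Module.Basis ι ℝ 𝔸) (κ : Type) [Fintype κ]

set_option maxHeartbeats 800000 in
/-- **THEOREM 3.4, `(Q′G′²Q′*)⁻¹(U′U)`-CLAUSE IN THE PRINTED KERNEL FORM (3.48), THRESHOLD BEFORE THE LATTICE** (p. 403 «an inverse of
the left-hand side can be expressed by a Neumann series convergent for α₁ sufficiently small. … The inverse satisfies Theorem 3.2»;
p. 399 «the constants … do not depend on the sequence {Ω_j}»): for fixed `d`, `κ`, `(𝔸, b, M₂)`, input constants `δ₀, κ_Q,
B_G, B₁, c_F, C_q, a₀, d₀` and ONE scale-transfer function `Λ(·) ≧ 1`, THERE EXISTS `a₁ > 0` such that FOR EVERY lattice `(S, T)`,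
geometry `𝔅 = g` with `blk` (axioms, [4] (2.61), scale transfer with `Λ(α)`), background `U`, (3.19)/(3.60) data, `G′(U)` with Theorem 3.1
(3.42)₁,₂ at `(B_G, δ₀)`, (3.19) letters `Q′`, `Q′*` (block-local, constant `κ_Q`) and `C⁻¹(U) = (Q′G′²Q′*)⁻¹` with Theorem 3.2's kernel
bound (3.48) at `(B₁, δ₀)`: for all `0 ≦ α₁ ≦ a₁`, all `A` in (3.37) (blockwise), (3.59) kernels and (3.57)/(3.59) letters `Q′(U′U) = Q′ + F′₂`,
`Q′*(U′U) = Q′* + F′₂*` of size `c_Fα₁`, THERE EXISTS `C⁻¹(U′U)`, two-sided inverse of `Q′(U′U)G′²(U′U)Q′*(U′U)`, with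
`|C⁻¹(U′U)(y,y′)| ≦ 2B₁c₁(2δ₀/5, 1/10)·(Lʲη)⁻⁴(L^{j′}η)^{−d}e^{−(9δ₀/25)d(y,y′)}` — constant AND threshold free of the lattice. (R1: [4] Lemma 2.1 (2.61) and the p. 398 scale transfer are hypothesised for the exponents
`9/5000 ≦ α` only — the ones the proof uses — instead of r06's «every 0 < α < 1»; nothing else differs from FILE 45.)
[cite: Balaban1985BackgroundPropagators, Thm 3.4 p.400 + p.399 + Thm 3.2 (3.48) p.398 + p.403 + (3.57) p.401 + (3.58)–(3.67) pp.402–403 + (3.19)/(3.21) pp.393–394 + Thm 3.1 (3.42) p.397 + (3.37) p.396; Balaban1984PropagatorsII, Lemma 2.1 p.234 + (2.51)–(2.55) p.232 + (2.66) p.234; Balaban1985Variational, (135) p.298] -/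
theorem thm34_Cinv_uniform [DecidableEq ι] (d : ℕ) (δ₀ κQ BG B₁ cF Cq a₀ d₀ M₂ : ℝ) (Λf : ℝ → ℝ)
    (hκQ : 0 < κQ) (hBG : 0 < BG) (hB₁ : 0 < B₁) (hcF : 0 < cF) (hCq : 0 ≤ Cq) (ha₀ : 0 ≤ a₀) (hM₂ : 0 ≤ M₂) (hδ₀ : 0 < δ₀)
    (hΛf : ∀ α : ℝ, 0 < α → 1 ≤ Λf α) (hrepr : ∀ (v : 𝔸) (i : ι), |b.repr v i| ≤ M₂ * ‖v‖) :
    ∃ a₁ : ℝ, 0 < a₁ ∧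
    ∀ {S : Type} [Fintype S] [DecidableEq S] (T : κ → Equiv.Perm S) (U : κ → S → 𝔸ˣ)
      {g : B9.Geometry} [Fintype g.Site] [DecidableEq g.Site] [Nonempty g.Site] {Rr : ℝ} {H : Prop} (blk : S → g.Site)
      (kQ : g.Site → S → 𝔸 →L[ℝ] 𝔸) (sQ : S → 𝔸 →L[ℝ] 𝔸) (cfun w : g.Site → ℝ),
    -- the multiscale geometry 𝔅 (p. 393, [4] (2.1)–(2.4)) and its axioms
      (∀ a a' : g.Site, 0 ≤ g.dist a a') → Triangle254 (toB6 g Rr H) → (∀ y : g.Site, g.dist y y = 0) →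
      (∀ y y' : g.Site, g.dist y y' = g.dist y' y) → (∀ y : g.Site, 0 < g.len y) → (∀ y : g.Site, g.eta ≤ g.len y) → 0 < g.eta →
    -- [4] Lemma 2.1 (2.61) at the rate `δ₀` and the p. 398 scale transfer with the constant `Λ(α)`, for every exponent `9/5000 ≤ α (< 1)` (R1: the exponents the proof uses)
      (∀ α : ℝ, 9 / 5000 ≤ α → α < 1 → Ineq261 d (toB6 g Rr H) δ₀ α) →
      (∀ α : ℝ, 9 / 5000 ≤ α → ScaleTransfer g δ₀ α (Λf α) (fun a => g.len a) ∧ ScaleTransfer g δ₀ α (Λf α) (fun a => g.len a ^ 2) ∧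
        ScaleTransfer g δ₀ α (Λf α) (fun a => (g.len a)⁻¹) ∧ ScaleTransfer g δ₀ α (Λf α) (fun a => (g.len a ^ 2)⁻¹) ∧
        ScaleTransfer g δ₀ α (Λf α) (fun a => (g.len a ^ 4)⁻¹) ∧ ScaleTransfer g δ₀ α (Λf α) (fun y => g.len y ^ (-(4 : ℝ)))) →
    -- unitary-type background, stencil geometry at range `d₀`
      (∀ m z, ‖((U m z : 𝔸ˣ) : 𝔸)‖ ≤ 1 ∧ ‖(((U m z)⁻¹ : 𝔸ˣ) : 𝔸)‖ ≤ 1) →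
      (∀ μ x, g.dist (blk x) (blk ((T μ).symm x)) ≤ d₀) → (∀ μ x, g.dist (blk x) (blk (T μ x)) ≤ d₀) →
      (∀ y : g.Site, g.dist y y ≤ d₀) →
    -- the `A`-independent data of the concrete `V′(A)` of (3.60)
      (∀ y, 0 ≤ w y) → (∀ y, ((B9Eq360Vprime.block blk y).card : ℝ) * w y ≤ 1) →
      (∀ y x, blk x = y → ‖kQ y x‖ ≤ w y) → (∀ x, ‖sQ x‖ ≤ 1) → (∀ y, |cfun y| ≤ a₀ * (g.len y ^ 2)⁻¹) →
    -- THEOREM 3.1 for `G′(U)`: (3.42)₁,₂ at the rate `δ₀`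
    ∀ {Gp : Module.End ℝ (S × ι → ℝ)},
      HasMajorant (g := toB6 g Rr H) (fun p : S × ι => blk p.1) Gp (fun a a' => BG * g.len a ^ 2 * Real.exp (-(δ₀ * g.dist a a'))) →
      (∀ k : κ ⊕ κ, HasMajorant (g := toB6 g Rr H) (fun p : S × ι => blk p.1)
        (conj b (diffLetter T U ((g.eta : ℂ)⁻¹) k) * Gp) (fun a a' => BG * g.len a * Real.exp (-(δ₀ * g.dist a a')))) →
    -- the (3.19) letters `Q′(U)`, `Q′*(U)` in their own typing with block-local two-space majorants
    ∀ {Qc : (S × ι → ℝ) →ₗ[ℝ] (g.Site → ℝ)} {Qcs : (g.Site → ℝ) →ₗ[ℝ] (S × ι → ℝ)} {Linv : Module.End ℝ (g.Site → ℝ)},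
      HasMajorantHom (g := toB6 g Rr H) (fun p : S × ι => blk p.1) (fun y : g.Site => y) Qc
        (fun a a' : g.Site => κQ * (if a = a' then (1 : ℝ) else 0)) →
      HasMajorantHom (g := toB6 g Rr H) (fun y : g.Site => y) (fun p : S × ι => blk p.1) Qcs
        (fun a a' : g.Site => κQ * (if a = a' then (1 : ℝ) else 0)) →
    -- THEOREM 3.2 for `U`: (3.21) `C⁻¹ = (Q′G′²Q′*)⁻¹` exists with the KERNEL bound (3.48) at the rate `δ₀`
      (Qc ∘ₗ (Gp * Gp) ∘ₗ Qcs) * Linv = 1 →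
      (∀ y y' : g.Site, |B9Thm34Inv.ker (B9Thm34Inv.vol g d) Linv y y'| ≤
        B₁ * g.len y ^ (-(4 : ℝ)) * g.len y' ^ (-(d : ℝ)) * Real.exp (-(δ₀ * g.dist y y'))) →
    ∀ (α₁ : ℝ), 0 ≤ α₁ → α₁ ≤ a₁ →
    ∀ (A : κ → S → 𝔸) (kF : g.Site → S → 𝔸 →L[ℝ] 𝔸) (sF : S → 𝔸 →L[ℝ] 𝔸),
      (∀ y x, blk x = y → ‖kF y x‖ ≤ Cq * α₁ * w y) → (∀ x, ‖sF x‖ ≤ Cq * α₁) →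
      (∀ ν k x, ‖((g.eta : ℂ)⁻¹) • covDstar T U ν (A k) x‖ ≤ α₁ * (g.len (blk x) ^ 2)⁻¹) →
      (∀ k x, ‖A k x‖ ≤ α₁ * (g.len (blk x))⁻¹) → (∀ ν k x, ‖tauB T U ν (A k) x‖ ≤ α₁ * (g.len (blk x))⁻¹) →
    ∀ {Qc' Fc : (S × ι → ℝ) →ₗ[ℝ] (g.Site → ℝ)} {Qcs' Fcs : (g.Site → ℝ) →ₗ[ℝ] (S × ι → ℝ)},
      Qc' = Qc + Fc → Qcs' = Qcs + Fcs →
      HasMajorantHom (g := toB6 g Rr H) (fun p : S × ι => blk p.1) (fun y : g.Site => y) Fc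
        (fun a a' : g.Site => cF * α₁ * (if a = a' then (1 : ℝ) else 0)) →
      HasMajorantHom (g := toB6 g Rr H) (fun y : g.Site => y) (fun p : S × ι => blk p.1) Fcs
        (fun a a' : g.Site => cF * α₁ * (if a = a' then (1 : ℝ) else 0)) →
    ∃ Tinv : Module.End ℝ (g.Site → ℝ),
      Tinv * (Qc' ∘ₗ ((gPrimeExtEnd Gp (conj b (vPrimeConc T U g.eta A blk kQ kF sQ sF cfun) * Gp)) * (gPrimeExtEnd Gp (conj b (vPrimeConc T U g.eta A blk kQ kF sQ sF cfun) * Gp))) ∘ₗ Qcs') = 1 ∧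
      (Qc' ∘ₗ ((gPrimeExtEnd Gp (conj b (vPrimeConc T U g.eta A blk kQ kF sQ sF cfun) * Gp)) * (gPrimeExtEnd Gp (conj b (vPrimeConc T U g.eta A blk kQ kF sQ sF cfun) * Gp))) ∘ₗ Qcs') * Tinv = 1 ∧
      ∀ y y' : g.Site, |B9Thm34Inv.ker (B9Thm34Inv.vol g d) Tinv y y'| ≤
        2 * B₁ * B6.c1 d (2 / 5 * δ₀) (1 / 10) * g.len y ^ (-(4 : ℝ)) * g.len y' ^ (-(d : ℝ)) * Real.exp (-(9 / 25 * δ₀ * g.dist y y')) := by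
  classical
  have hSb : 0 ≤ ∑ i, ‖b i‖ := Finset.sum_nonneg fun i _ => norm_nonneg _
  -- the two scale-transfer constants of the chain, READ FROM THE GIVEN FUNCTION `Λ(·)` (lattice-free)
  have hΛ : 1 ≤ Λf (1 / 100) := hΛf _ (by norm_num)
  have hc₄1 : 1 ≤ Λf (1 / 10) := hΛf _ (by norm_num)
  have hΛ0 : 0 < Λf (1 / 100) := zero_lt_one.trans_le hΛ
  have hc₄ : 0 < Λf (1 / 10) := zero_lt_one.trans_le hc₄1
  -- «for α₁ sufficiently small» (p. 403): the two threshold functions of the chain are continuous at `α₁ = 0` and vanish there — NO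
  -- lattice datum enters
  obtain ⟨ε₁, hε₁, hF1⟩ := exists_threshold_of_continuousAt
    (f := fun α₁ : ℝ => theta363 (Fintype.card κ) 1 α₁ a₀ Cq M₂ (∑ i, ‖b i‖) (Real.exp (δ₀ * d₀)) BG (Λf (1 / 100)) (B6.c1 d δ₀ (1 / 100)) *
      B6.c1 d (49 / 50 * δ₀) (1 / 100))
    (by unfold theta363 kappa385 cVConc cBConc; fun_prop) (by simp [theta363])
  obtain ⟨ε₅, hε₅, hF5⟩ := exists_threshold_of_continuousAt
    (f := fun α₁ : ℝ => α₁ * (2 * (kappa366 κQ cF (kappa385 1 (cVConc (Fintype.card κ) 1 α₁ a₀ Cq M₂ (∑ i, ‖b i‖) (Real.exp (δ₀ * d₀))) 0 0 (Λf (1 / 100)) (B6.c1 d δ₀ (1 / 100))) BG (BG * B6.c1 d (49 / 50 * δ₀) (1 / 100) * (1 - theta363 (Fintype.card κ) 1 α₁ a₀ Cq M₂ (∑ i, ‖b i‖) (Real.exp (δ₀ * d₀)) BG (Λf (1 / 100)) (B6.c1 d δ₀ (1 / 100)) * B6.c1 d (49 / 50 * δ₀) (1 / 100))⁻¹) (Λf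 (1 / 100)) (B6.c1 d δ₀ (1 / 100)) α₁ * B₁ * Λf (1 / 10) * B6.c1 d δ₀ (1 / 2 + 1 / 10)) * B6.c1 d ((1 / 2 - 1 / 10) * δ₀) (1 / 10)))
    (by
      unfold theta363 kappa366 kappa385 cVConc cBConc
      fun_prop (disch := simp))
    (by simp)
  refine ⟨min (min ε₁ ε₅) (1 / 2) / 2, half_pos (lt_min (lt_min hε₁ hε₅) one_half_pos), ?_⟩
  -- NOW the lattice, the background, the data and Theorems 3.1/3.2 for `U`
  intro S _ _ T U g _ _ _ Rr H blk kQ sQ cfun w hdnn htri hrefl hsym hlen hlenη hη h261 hST hU1 hd₀B hd₀F hd₀0 hw hcard hkQ hsQ hcfun Gp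
    h342_1 h342_2 Qc Qcs Linv hQc hQcs hLinv h348 α₁ hα₁0 hα₁1 A kF sF hkF hsF h337B hA hAτB Qc' Fc Qcs' Fcs h357 h357s hFc hFcs
  obtain ⟨y₀⟩ := ‹Nonempty g.Site›
  -- the p. 398 scale transfers and [4] Lemma 2.1 at the pairs of the `C⁻¹(U′U)`-chain
  obtain ⟨hT1, hT2, -, -, -, -⟩ := hST (1 / 100) (by norm_num)
  obtain ⟨-, -, -, -, -, hT4v⟩ := hST (1 / 10) (by norm_num)
  have h261β : Ineq261 d (toB6 g Rr H) δ₀ (1 / 100) := h261 _ (by norm_num) (by norm_num)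
  have h261c : Ineq261 d (toB6 g Rr H) (49 / 50 * δ₀) (1 / 100) :=
    ineq261_rescale (h261 (1 / 100 * (49 / 50)) (by norm_num) (by norm_num))
  have h261v : Ineq261 d (toB6 g Rr H) δ₀ (1 / 2 + 1 / 10) := h261 _ (by norm_num) (by norm_num)
  have h261v' : Ineq261 d (toB6 g Rr H) ((1 / 2 - 1 / 10) * δ₀) (1 / 10) :=
    ineq261_rescale (h261 (1 / 10 * (1 / 2 - 1 / 10)) (by norm_num) (by norm_num))
  have hc₂ : 0 < B6.c1 d δ₀ (1 / 100) := c1_pos_of_ineq261 h261β y₀ (hrefl y₀)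
  have hcc' : 0 < B6.c1 d (49 / 50 * δ₀) (1 / 100) := c1_pos_of_ineq261 h261c y₀ (hrefl y₀)
  have hc₁v : 0 < B6.c1 d δ₀ (1 / 2 + 1 / 10) := c1_pos_of_ineq261 h261v y₀ (hrefl y₀)
  have hc₁v' : 0 < B6.c1 d ((1 / 2 - 1 / 10) * δ₀) (1 / 10) := c1_pos_of_ineq261 h261v' y₀ (hrefl y₀)
  have hrc1 : 49 / 50 * δ₀ + (1 / 100 + 1 / 100) * δ₀ ≤ δ₀ := by linarith only [hδ₀]
  have hrc : δ₀ / 2 + (1 / 100 + 1 / 100) * δ₀ ≤ (1 - 1 / 100) * (49 / 50 * δ₀) := by linarith only [hδ₀]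
  have hρc0 : 0 ≤ 49 / 50 * δ₀ := by linarith only [hδ₀]
  have hmε₁ : min (min ε₁ ε₅) (1 / 2) ≤ ε₁ := (min_le_left _ _).trans (min_le_left _ _)
  have hmε₅ : min (min ε₁ ε₅) (1 / 2) ≤ ε₅ := (min_le_left _ _).trans (min_le_right _ _)
  have hmh : min (min ε₁ ε₅) (1 / 2) ≤ 1 / 2 := min_le_right _ _
  have habs : |α₁| = α₁ := abs_of_nonneg hα₁0
  have h1 : theta363 (Fintype.card κ) 1 α₁ a₀ Cq M₂ (∑ i, ‖b i‖) (Real.exp (δ₀ * d₀)) BG (Λf (1 / 100)) (B6.c1 d δ₀ (1 / 100)) *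
      B6.c1 d (49 / 50 * δ₀) (1 / 100) < 1 / 2 :=
    hF1 α₁ (by rw [habs]; linarith only [hα₁1, hmε₁, hε₁])
  have h5 : α₁ * (2 * (kappa366 κQ cF (kappa385 1 (cVConc (Fintype.card κ) 1 α₁ a₀ Cq M₂ (∑ i, ‖b i‖) (Real.exp (δ₀ * d₀))) 0 0 (Λf (1 / 100)) (B6.c1 d δ₀ (1 / 100))) BG (BG * B6.c1 d (49 / 50 * δ₀) (1 / 100) * (1 - theta363 (Fintype.card κ) 1 α₁ a₀ Cq M₂ (∑ i, ‖b i‖) (Real.exp (δ₀ * d₀)) BG (Λf (1 / 100)) (B6.c1 d δ₀ (1 / 100)) * B6.c1 d (49 / 50 * δ₀) (1 / 100))⁻¹) (Λf (1 / 100)) (B6.c1 d δ₀ (1 / 100)) α₁ * B₁ * Λf (1 / 10) * B6.c1 d δ₀ (1 / 2 + 1 / 10)) * B6.c1 d ((1 / 2 - 1 / 10) * δ₀) (1 / 10)) < 1 / 2 :=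
    hF5 α₁ (by rw [habs]; linarith only [hα₁1, hmε₅, hε₅])
  have hhalf : (1 / 2 : ℝ) < 1 := by norm_num
  -- `η·α₁(Lʲη)⁻¹ ≦ 1/4` from `α₁ ≦ 1/4` and `η ≦ Lʲη`
  have hsmall : ∀ y : g.Site, g.eta * (α₁ * (g.len y)⁻¹) ≤ 1 / 4 := fun y => by
    have hq : g.eta * (g.len y)⁻¹ ≤ 1 := by
      rw [← div_eq_mul_inv]; exact (div_le_one (hlen y)).mpr (hlenη y)
    calc g.eta * (α₁ * (g.len y)⁻¹) = α₁ * (g.eta * (g.len y)⁻¹) := by ring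
      _ ≤ α₁ * 1 := mul_le_mul_of_nonneg_left hq hα₁0
      _ ≤ 1 / 4 := by linarith only [hα₁1, hmh]
  -- signs of the explicit constants at this `α₁`, and the explicit threshold `ha₁'`
  have hcV0E : ∀ E : ℝ, 0 ≤ E →
      0 ≤ kappa385 1 (cVConc (Fintype.card κ) 1 α₁ a₀ Cq M₂ (∑ i, ‖b i‖) E) 0 0 (Λf (1 / 100)) (B6.c1 d δ₀ (1 / 100)) := fun E hE =>
    kappa385_nonneg zero_le_one (cVConc_nonneg hα₁0 ha₀ hCq hM₂ hSb hE) le_rfl le_rfl hΛ0.le hc₂.le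
  have hNc : 0 < BG * B6.c1 d (49 / 50 * δ₀) (1 / 100) * (1 - theta363 (Fintype.card κ) 1 α₁ a₀ Cq M₂ (∑ i, ‖b i‖) (Real.exp (δ₀ * d₀)) BG (Λf (1 / 100)) (B6.c1 d δ₀ (1 / 100)) * B6.c1 d (49 / 50 * δ₀) (1 / 100))⁻¹ :=
    mul_pos (mul_pos hBG hcc') (inv_pos.mpr (by linarith only [h1]))
  have hκC0 : 0 < kappa366 κQ cF (kappa385 1 (cVConc (Fintype.card κ) 1 α₁ a₀ Cq M₂ (∑ i, ‖b i‖) (Real.exp (δ₀ * d₀))) 0 0 (Λf (1 / 100)) (B6.c1 d δ₀ (1 / 100))) BG (BG * B6.c1 d (49 / 50 * δ₀) (1 / 100) * (1 - theta363 (Fintype.card κ) 1 α₁ a₀ Cq M₂ (∑ i, ‖b i‖) (Real.exp (δ₀ * d₀)) BG (Λf (1 / 100)) (B6.c1 d δ₀ (1 / 100)) * B6.c1 d (49 / 50 * δ₀) (1 / 100))⁻¹) (Λf (1 / 100)) (B6.c1 d δ₀ (1 / 100)) α₁ :=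
    kappa366_pos hκQ hcF (hcV0E _ (Real.exp_nonneg _)) hNc hΛ0 hc₂ hα₁0
  have hXpos : 0 < 2 * (kappa366 κQ cF (kappa385 1 (cVConc (Fintype.card κ) 1 α₁ a₀ Cq M₂ (∑ i, ‖b i‖) (Real.exp (δ₀ * d₀))) 0 0 (Λf (1 / 100)) (B6.c1 d δ₀ (1 / 100))) BG (BG * B6.c1 d (49 / 50 * δ₀) (1 / 100) * (1 - theta363 (Fintype.card κ) 1 α₁ a₀ Cq M₂ (∑ i, ‖b i‖) (Real.exp (δ₀ * d₀)) BG (Λf (1 / 100)) (B6.c1 d δ₀ (1 / 100)) * B6.c1 d (49 / 50 * δ₀) (1 / 100))⁻¹) (Λf (1 / 100)) (B6.c1 d δ₀ (1 / 100)) α₁ * B₁ * Λf (1 / 10) * B6.c1 d δ₀ (1 / 2 + 1 / 10)) * B6.c1 d ((1 / 2 - 1 / 10) * δ₀) (1 / 10) :=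
    mul_pos (mul_pos two_pos (mul_pos (mul_pos (mul_pos hκC0 hB₁) hc₄) hc₁v)) hc₁v'
  have ha₁' : α₁ ≤ (2 * (kappa366 κQ cF (kappa385 1 (cVConc (Fintype.card κ) 1 α₁ a₀ Cq M₂ (∑ i, ‖b i‖) (Real.exp (δ₀ * d₀))) 0 0 (Λf (1 / 100)) (B6.c1 d δ₀ (1 / 100))) BG (BG * B6.c1 d (49 / 50 * δ₀) (1 / 100) * (1 - theta363 (Fintype.card κ) 1 α₁ a₀ Cq M₂ (∑ i, ‖b i‖) (Real.exp (δ₀ * d₀)) BG (Λf (1 / 100)) (B6.c1 d δ₀ (1 / 100)) * B6.c1 d (49 / 50 * δ₀) (1 / 100))⁻¹) (Λf (1 / 100)) (B6.c1 d δ₀ (1 / 100)) α₁ * B₁ * Λf (1 / 10) * B6.c1 d δ₀ (1 / 2 + 1 / 10)) * B6.c1 d ((1 / 2 - 1 / 10) * δ₀) (1 / 10))⁻¹ := by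
    rw [inv_eq_one_div, le_div_iff₀ hXpos]; linarith only [h5]
  -- the shapes gen 9's `B9Ineq366Vprime` reads (3.37) / the stencil geometry in
  have hA' : ∀ μ x, ‖A μ x‖ ≤ α₁ * (g.len (blk x))⁻¹ ∧ ‖tauB T U μ (A μ) x‖ ≤ α₁ * (g.len (blk x))⁻¹ :=
    fun μ x => ⟨hA μ x, hAτB μ μ x⟩
  have h337s' : ∀ μ x, ‖((g.eta : ℂ)⁻¹) • covDstar T U μ (A μ) x‖ ≤ α₁ * (g.len (blk x) ^ 2)⁻¹ := fun μ x => h337B μ μ x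
  have hd₀' : ∀ μ x, g.dist (blk x) (blk (T μ x)) ≤ d₀ ∧ g.dist (blk x) (blk ((T μ).symm x)) ≤ d₀ :=
    fun μ x => ⟨hd₀F μ x, hd₀B μ x⟩
  -- «The inverse satisfies Theorem 3.2» (gen 9)
  obtain ⟨Tinv, hTl, hTr, hTker⟩ := inverse_satisfies_thm32_vPrime (Rr := Rr) (H := H) b T U blk d hη A kQ kF sQ sF cfun w 1 d₀ M₂ Cq a₀
    δ₀ δ₀ (1 / 100) (1 / 100) (49 / 50 * δ₀) (Λf (1 / 100)) BG α₁ (1 / 100) κQ cF (1 / 10) (1 / 10) (Λf (1 / 10)) B₁ hBG hα₁0 hΛ0 hρc0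
    (by norm_num) (by norm_num) hδ₀ hδ₀.le hκQ hcF (by norm_num) (by norm_num) (by norm_num) hc₄ hB₁ hrc1 (by norm_num) (by norm_num) hrc
    hc₁v hc₁v' hc₂ hcc' hdnn hrefl hsym htri hlen h261β h261c h261v h261v' hT1 hT2 hT4v hM₂ hrepr hsmall hA' h337s' hU1 hd₀' hd₀0 hw
    hcard hCq ha₀ hkQ hkF hsQ hsF hcfun (h1.trans hhalf) h342_1 h342_2 h357 h357s hQc hQcs hFc hFcs hLinv h348 ha₁'
  refine ⟨Tinv, hTl, hTr, fun y y' => ?_⟩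
  have h := hTker y y'
  have e1 : B6.c1 d ((1 / 2 - 1 / 10) * δ₀) (1 / 10) = B6.c1 d (2 / 5 * δ₀) (1 / 10) := by norm_num
  have e2 : Real.exp (-((1 - 1 / 10) * ((1 / 2 - 1 / 10) * δ₀) * g.dist y y')) = Real.exp (-(9 / 25 * δ₀ * g.dist y y')) := by
    congr 1; ring
  rw [e1, e2] at h
  exact h

end CInv

/-! ## §3  «There exists a positive constant a₁ such that the operators G′(U), (Q′(U)G′²(U)Q′*(U))⁻¹ … extend» — ONE `a₁`, ONE `B` for both
clauses, chosen before the lattice -/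

section Both

variable {𝔸 : Type*} [NormedRing 𝔸] [NormedAlgebra ℂ 𝔸] [CompleteSpace 𝔸] {ι : Type} [Fintype ι]
variable (b : Module.Basis ι ℝ 𝔸) (κ : Type) [Fintype κ]

set_option maxHeartbeats 800000 in
/-- **THEOREM 3.4 FOR `G′(U′U)` AND `(Q′G′²Q′*)⁻¹(U′U)` TOGETHER, ONE THRESHOLD AND ONE CONSTANT BEFORE THE LATTICE** («There exists a
positive constant a₁ such that the operators G′(U), (Q′(U)G′²(U)Q′*(U))⁻¹, R(U), G(U) extend to configurations U′U for α₁ ≦ a₁ … The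
extended operators satisfy all the inequalities of Theorems 3.1–3.3 correspondingly», p. 400; «the constants … do not depend on the sequence
{Ω_j}», p. 399), for the first two operators and the sup/kernel members: for fixed `d`, `κ`, `(𝔸, b, M₂)`, input constants and ONE
scale-transfer function `Λ(·) ≧ 1`, `∃ a₁ > 0 ∃ B ≧ 0` such that for EVERY lattice, geometry, background, (3.19)/(3.24)/(3.60) data,
`G′(U) = (Δ′_a(U))⁻¹` with Theorem 3.1 (3.42)₁₋₃ at `(B_G, δ₀)`, (3.19) letters and `C⁻¹(U)` with Theorem 3.2 (3.48) at `(B₁, δ₀)`, and every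
`0 ≦ α₁ ≦ a₁`, `A` in (3.37), (3.59) kernels: §1's conclusions for `G′(U′U)` at `(B, 9δ₀/10)` AND, for all (3.57)/(3.59) letters, §2's
`C⁻¹(U′U)` with the kernel bound `2B₁c₁(2δ₀/5, 1/10)(Lʲη)⁻⁴(L^{j′}η)^{−d}e^{−(9δ₀/25)d}`.  PROOF: `a₁ = min` of §1's and §2's. (R1: [4] Lemma 2.1 (2.61) and the p. 398 scale transfer are hypothesised for the exponents
`9/5000 ≦ α` only — the ones the proof uses — instead of r06's «every 0 < α < 1»; nothing else differs from FILE 45.)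
[cite: Balaban1985BackgroundPropagators, Thm 3.4 p.400 + p.399 + p.402 + p.403 + Thm 3.1 (3.42) p.397 + Thm 3.2 (3.48) p.398 + (3.19)/(3.21)/(3.24) pp.393–394 + (3.57) p.401 + (3.59)–(3.67) pp.402–403 + (3.37) p.396; Balaban1984PropagatorsII, Lemma 2.1 p.234 + (2.66) p.234] -/
theorem thm34_GpCinv_uniform [DecidableEq ι] (d : ℕ) (δ₀ κQ BG B₁ cF Cq a₀ d₀ M₂ : ℝ) (Λf : ℝ → ℝ)
    (hκQ : 0 < κQ) (hBG : 0 < BG) (hB₁ : 0 < B₁) (hcF : 0 < cF) (hCq : 0 ≤ Cq) (ha₀ : 0 ≤ a₀) (hM₂ : 0 ≤ M₂) (hδ₀ : 0 < δ₀)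
    (hΛf : ∀ α : ℝ, 0 < α → 1 ≤ Λf α) (hrepr : ∀ (v : 𝔸) (i : ι), |b.repr v i| ≤ M₂ * ‖v‖) :
    ∃ a₁ : ℝ, 0 < a₁ ∧ ∃ B : ℝ, 0 ≤ B ∧
    ∀ {S : Type} [Fintype S] [DecidableEq S] (T : κ → Equiv.Perm S) (U : κ → S → 𝔸ˣ)
      {g : B9.Geometry} [Fintype g.Site] [DecidableEq g.Site] [Nonempty g.Site] {Rr : ℝ} {H : Prop} (blk : S → g.Site)
      (kQ : g.Site → S → 𝔸 →L[ℝ] 𝔸) (sQ : S → 𝔸 →L[ℝ] 𝔸) (cfun w : g.Site → ℝ),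
      (∀ a a' : g.Site, 0 ≤ g.dist a a') → Triangle254 (toB6 g Rr H) → (∀ y : g.Site, g.dist y y = 0) →
      (∀ y y' : g.Site, g.dist y y' = g.dist y' y) → (∀ y : g.Site, 0 < g.len y) → (∀ y : g.Site, g.eta ≤ g.len y) → 0 < g.eta →
      (∀ α : ℝ, 9 / 5000 ≤ α → α < 1 → Ineq261 d (toB6 g Rr H) δ₀ α) →
      (∀ α : ℝ, 9 / 5000 ≤ α → ScaleTransfer g δ₀ α (Λf α) (fun a => g.len a) ∧ ScaleTransfer g δ₀ α (Λf α) (fun a => g.len a ^ 2) ∧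
        ScaleTransfer g δ₀ α (Λf α) (fun a => (g.len a)⁻¹) ∧ ScaleTransfer g δ₀ α (Λf α) (fun a => (g.len a ^ 2)⁻¹) ∧
        ScaleTransfer g δ₀ α (Λf α) (fun a => (g.len a ^ 4)⁻¹) ∧ ScaleTransfer g δ₀ α (Λf α) (fun y => g.len y ^ (-(4 : ℝ)))) →
      (∀ m z, ‖((U m z : 𝔸ˣ) : 𝔸)‖ ≤ 1 ∧ ‖(((U m z)⁻¹ : 𝔸ˣ) : 𝔸)‖ ≤ 1) →
      (∀ μ x, g.dist (blk x) (blk ((T μ).symm x)) ≤ d₀) → (∀ μ x, g.dist (blk x) (blk (T μ x)) ≤ d₀) →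
      (∀ y : g.Site, g.dist y y ≤ d₀) →
      (∀ y, 0 ≤ w y) → (∀ y, ((B9Eq360Vprime.block blk y).card : ℝ) * w y ≤ 1) →
      (∀ y x, blk x = y → ‖kQ y x‖ ≤ w y) → (∀ x, ‖sQ x‖ ≤ 1) → (∀ y, |cfun y| ≤ a₀ * (g.len y ^ 2)⁻¹) →
    -- THEOREM 3.1 for `G′(U)`: (3.24) two-sided inverse of the letter `Δ′_a(U)`, (3.42)₁,₂,₃ at the rate `δ₀`
    ∀ {Δp Gp : Module.End ℝ (S × ι → ℝ)}, Δp * Gp = 1 → Gp * Δp = 1 →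
      HasMajorant (g := toB6 g Rr H) (fun p : S × ι => blk p.1) Gp (fun a a' => BG * g.len a ^ 2 * Real.exp (-(δ₀ * g.dist a a'))) →
      (∀ k : κ ⊕ κ, HasMajorant (g := toB6 g Rr H) (fun p : S × ι => blk p.1)
        (conj b (diffLetter T U ((g.eta : ℂ)⁻¹) k) * Gp) (fun a a' => BG * g.len a * Real.exp (-(δ₀ * g.dist a a')))) →
      (∀ k : κ ⊕ κ, HasMajorant (g := toB6 g Rr H) (fun p : S × ι => blk p.1)
        (Gp * conj b (diffLetter T U ((g.eta : ℂ)⁻¹) k)) (fun a a' => BG * g.len a * Real.exp (-(δ₀ * g.dist a a')))) →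
    -- the (3.19) letters and THEOREM 3.2 for `U`
    ∀ {Qc : (S × ι → ℝ) →ₗ[ℝ] (g.Site → ℝ)} {Qcs : (g.Site → ℝ) →ₗ[ℝ] (S × ι → ℝ)} {Linv : Module.End ℝ (g.Site → ℝ)},
      HasMajorantHom (g := toB6 g Rr H) (fun p : S × ι => blk p.1) (fun y : g.Site => y) Qc
        (fun a a' : g.Site => κQ * (if a = a' then (1 : ℝ) else 0)) →
      HasMajorantHom (g := toB6 g Rr H) (fun y : g.Site => y) (fun p : S × ι => blk p.1) Qcs
        (fun a a' : g.Site => κQ * (if a = a' then (1 : ℝ) else 0)) →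
      (Qc ∘ₗ (Gp * Gp) ∘ₗ Qcs) * Linv = 1 →
      (∀ y y' : g.Site, |B9Thm34Inv.ker (B9Thm34Inv.vol g d) Linv y y'| ≤
        B₁ * g.len y ^ (-(4 : ℝ)) * g.len y' ^ (-(d : ℝ)) * Real.exp (-(δ₀ * g.dist y y'))) →
    ∀ (α₁ : ℝ), 0 ≤ α₁ → α₁ ≤ a₁ →
    ∀ (A : κ → S → 𝔸) (kF : g.Site → S → 𝔸 →L[ℝ] 𝔸) (sF : S → 𝔸 →L[ℝ] 𝔸),
      (∀ y x, blk x = y → ‖kF y x‖ ≤ Cq * α₁ * w y) → (∀ x, ‖sF x‖ ≤ Cq * α₁) →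
      (∀ ν k x, ‖((g.eta : ℂ)⁻¹) • covDstar T U ν (A k) x‖ ≤ α₁ * (g.len (blk x) ^ 2)⁻¹) →
      (∀ μ ν x, ‖((g.eta : ℂ)⁻¹) • covD T U μ (A ν) x‖ ≤ α₁ * (g.len (blk x) ^ 2)⁻¹) →
      (∀ μ x, ‖((g.eta : ℂ)⁻¹) • covDstar T U μ (tauB T U μ (A μ)) x‖ ≤ α₁ * (g.len (blk x) ^ 2)⁻¹) →
      (∀ k x, ‖A k x‖ ≤ α₁ * (g.len (blk x))⁻¹) → (∀ ν k x, ‖tauB T U ν (A k) x‖ ≤ α₁ * (g.len (blk x))⁻¹) →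
      ((Δp - conj b (vPrimeConc T U g.eta A blk kQ kF sQ sF cfun)) * (gPrimeExtEnd Gp (conj b (vPrimeConc T U g.eta A blk kQ kF sQ sF cfun) * Gp)) = 1 ∧
      (gPrimeExtEnd Gp (conj b (vPrimeConc T U g.eta A blk kQ kF sQ sF cfun) * Gp)) * (Δp - conj b (vPrimeConc T U g.eta A blk kQ kF sQ sF cfun)) = 1 ∧
      (∀ (X : Module.End ℝ (S × ι → ℝ)) (P : g.Site → ℝ), (∀ y, 0 ≤ P y) →
        HasMajorant (g := toB6 g Rr H) (fun p : S × ι => blk p.1) (X * Gp) (fun a a' => BG * P a * Real.exp (-(δ₀ * g.dist a a'))) →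
        HasMajorant (g := toB6 g Rr H) (fun p : S × ι => blk p.1) (X * (gPrimeExtEnd Gp (conj b (vPrimeConc T U g.eta A blk kQ kF sQ sF cfun) * Gp)))
          (fun a a' => B * P a * Real.exp (-(9 / 10 * δ₀ * g.dist a a')))) ∧
      (∀ Y : Module.End ℝ (S × ι → ℝ),
        HasMajorant (g := toB6 g Rr H) (fun p : S × ι => blk p.1) (Gp * Y) (fun a a' => BG * g.len a * Real.exp (-(δ₀ * g.dist a a'))) →
        HasMajorant (g := toB6 g Rr H) (fun p : S × ι => blk p.1) ((gPrimeExtEnd Gp (conj b (vPrimeConc T U g.eta A blk kQ kF sQ sF cfun) * Gp)) * Y)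
          (fun a a' => B * g.len a * Real.exp (-(9 / 10 * δ₀ * g.dist a a'))))) ∧
    ∀ {Qc' Fc : (S × ι → ℝ) →ₗ[ℝ] (g.Site → ℝ)} {Qcs' Fcs : (g.Site → ℝ) →ₗ[ℝ] (S × ι → ℝ)},
      Qc' = Qc + Fc → Qcs' = Qcs + Fcs →
      HasMajorantHom (g := toB6 g Rr H) (fun p : S × ι => blk p.1) (fun y : g.Site => y) Fc
        (fun a a' : g.Site => cF * α₁ * (if a = a' then (1 : ℝ) else 0)) →
      HasMajorantHom (g := toB6 g Rr H) (fun y : g.Site => y) (fun p : S × ι => blk p.1) Fcs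
        (fun a a' : g.Site => cF * α₁ * (if a = a' then (1 : ℝ) else 0)) →
    ∃ Tinv : Module.End ℝ (g.Site → ℝ),
      Tinv * (Qc' ∘ₗ ((gPrimeExtEnd Gp (conj b (vPrimeConc T U g.eta A blk kQ kF sQ sF cfun) * Gp)) * (gPrimeExtEnd Gp (conj b (vPrimeConc T U g.eta A blk kQ kF sQ sF cfun) * Gp))) ∘ₗ Qcs') = 1 ∧
      (Qc' ∘ₗ ((gPrimeExtEnd Gp (conj b (vPrimeConc T U g.eta A blk kQ kF sQ sF cfun) * Gp)) * (gPrimeExtEnd Gp (conj b (vPrimeConc T U g.eta A blk kQ kF sQ sF cfun) * Gp))) ∘ₗ Qcs') * Tinv = 1 ∧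
      ∀ y y' : g.Site, |B9Thm34Inv.ker (B9Thm34Inv.vol g d) Tinv y y'| ≤
        2 * B₁ * B6.c1 d (2 / 5 * δ₀) (1 / 10) * g.len y ^ (-(4 : ℝ)) * g.len y' ^ (-(d : ℝ)) * Real.exp (-(9 / 25 * δ₀ * g.dist y y')) := by
  obtain ⟨a₁, ha₁, B, hB, H1⟩ := thm34_Gp_uniform b κ d δ₀ BG Cq a₀ d₀ M₂ Λf hBG hCq ha₀ hM₂ hδ₀ hΛf hrepr
  obtain ⟨a₂, ha₂, H2⟩ := thm34_Cinv_uniform b κ d δ₀ κQ BG B₁ cF Cq a₀ d₀ M₂ Λf hκQ hBG hB₁ hcF hCq ha₀ hM₂ hδ₀ hΛf hrepr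
  refine ⟨min a₁ a₂, lt_min ha₁ ha₂, B, hB, ?_⟩
  intro S _ _ T U g _ _ _ Rr H blk kQ sQ cfun w hdnn htri hrefl hsym hlen hlenη hη h261 hST hU1 hd₀B hd₀F hd₀0 hw hcard hkQ hsQ hcfun Δp Gp
    hΔpGp hGpΔp h342_1 h342_2 h342_3 Qc Qcs Linv hQc hQcs hLinv h348 α₁ hα₁0 hα₁1 A kF sF hkF hsF h337B h337F h337Bτ hA hAτB
  exact ⟨H1 T U blk kQ sQ cfun w hdnn htri hrefl hsym hlen hlenη hη h261 hST hU1 hd₀B hd₀F hd₀0 hw hcard hkQ hsQ hcfun hΔpGp hGpΔp h342_1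
      h342_2 h342_3 α₁ hα₁0 (hα₁1.trans (min_le_left _ _)) A kF sF hkF hsF h337B h337F h337Bτ hA hAτB,
    fun h357 h357s hFc hFcs => H2 T U blk kQ sQ cfun w hdnn htri hrefl hsym hlen hlenη hη h261 hST hU1 hd₀B hd₀F hd₀0 hw hcard hkQ hsQ
      hcfun h342_1 h342_2 hQc hQcs hLinv h348 α₁ hα₁0 (hα₁1.trans (min_le_right _ _)) A kF sF hkF hsF h337B hA hAτB h357 h357s hFc hFcs⟩

end Both

end Literature.MathematicalPhysics.QuantumFieldTheory.Balaban1983to89.B9Thm34SectBUniformR1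

end
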